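import Summits.BirchSwinnertonDyer.Rank1Residual.X1.LocalPackageRat
import HarnessLib

/-!
# THE LOCAL PACKAGE at the prime of `ℚ_n` above `p`, over `ℚ`: the STRICTNESS CLAUSE of
# `X1/GeneratorCountLayerAtPStrict` (cell `b2b-bsdres`, unit `b2b-bsdres-eisenstein-p1`, gen 20;
# X1R0-GAPMAP §29; memo `V76-LOCAL-TERM-PLAN` §5 (M1-local))

HONEST FRAMING (cell `b2b-bsdres`, verbatim in every file): prove what is provable now; nothing is
booked; no label changes. THEOREMS ONLY. `X1/LocalPackageRat.exists_addSubgroup_redStrict` gives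
`𝓛 ≤ H¹((ℚ_n)_wp, E[p])` (`𝓚 ≤ 𝓛`, `p²·#𝓚 ≤ #𝓛`) whose classes have cocycles reducing to `Õ` on the
elements of `I_{(ℚ_n)_wp}` restricting into `Gal(ℚ̄/ℚ_{n,∞})`. Here this is turned into the exact
`hstrict` clause of FILE 24b (`X1/GeneratorCountLayerAtPStrict.pow_card_add_le_pow_mul_sq_of_strict_of_ordinary`):
for every cocycle `φ` over `ℚ_n` whose class localises into `𝓛` and every `x ∈ I_v ∩ Gal(ℚ̄/ℚ_∞)`,
`localRed(pointsMap(β⁻¹ φ(kerOfKer x))) = Õ`: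

* §1 `exists_absInertia_resGal_eq`: `x = res d` with `d ∈ I_{ℚ_v}` (`inertia v` is the image of
  `absInertia ℚ_v`), and `g = ι₂ d ι₂⁻¹ ∈ I_{(ℚ_n)_wp}` (`X1/SpectralNormTransport`) has
  `resGal(res_{ι'} g) = res d = x` (`resGal_resGalOfEmb_transportAut`);
* §2 `mem_kerSubgroup_and_eq_kerOfKer`: `res_{ι'} g ∈ ker κ_n` (`ker κ_n = resGal⁻¹ ker κ`) and
  `res_{ι'} g = kerOfKer x` (through `kerToKer`); `absGaloisRestrict_mem_kerSubgroup`: `res g =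
  τ (res_{ι'} g) τ⁻¹ ∈ ker κ_n` (`ι' = ι_{L_w} ∘ τ`);
* §3 `localRed_eq_zero_of_red_eq_zero`: `red(pointsMap(τ • Q)) = red((ι')_* Q)` and "reduces to
  `Õ`" transports back to `ℚ_v` (`X1/LocalPackageTransportPoints`);
* §4 `exists_strict_addSubgroup_of_red` / `exists_strict_addSubgroup`: the package with FILE 24b's
  clause, for a given reduction datum / for the minimal model over the valuation ring of `|·|_wp`.

References: [GreenbergLNM1716] §2 Prop. 2.4, §3 Lemma 3.4 (p. 89), §5 pp. 114–118;
[MilneADT2006] I Thm. 2.8; [SilvermanAEC2009] VII.§2–3; [SerreGaloisCohomology1997] II.§1.1;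
[Washington1997] §13.1.
-/

noncomputable section

open scoped Classical NNReal

open Function Field NumberField IsDedekindDomain WeierstrassCurve
  Literature.NumberTheory.EllipticCurves Literature.NumberTheory.GaloisRepresentations
  IsDedekindDomain.HeightOneSpectrum
  Summit.BirchSwinnertonDyer.Rank1Residual.Additive.LocalTransport
  Summit.BirchSwinnertonDyer.Rank1Residual.Additive
  Summit.BirchSwinnertonDyer.Rank1Residual.Additive.ZpTower
  Summit.BirchSwinnertonDyer.Rank1Residual.X2.GreenbergVatsalReductionDatum
open Literature.NumberTheory.EllipticCurves.GreenbergSelmer (inertiaIn inertiaInToH inertia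
  mem_inertiaIn_iff)

set_option autoImplicit false

-- NB (as in `X1/LocalPackageRat`): no local `[NumberField (κ.layer n)]` hypotheses; Galois elements
-- are kept as opaque locals and equations between them are used through `simp only` (reducible
-- matching), since `isDefEq` unfolding `resGalOfEmb`/`transportAut`/`pointsMap` and the two
-- `Algebra ℚ ℚ_n` instance paths is what exhausts heartbeats here.

namespace Summit.BirchSwinnertonDyer.Rank1Residual.X1.LocalPackageRatStrict

variable (W : WeierstrassCurve ℚ) [W.IsElliptic] [W.IsGloballyMinimal] {p : ℕ} [hp : Fact p.Prime]
  (κ : ZpExtension ℚ p) (n : ℕ) (κn : ZpExtension (κ.layer n) p)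
  (hκn : ∀ σ : Field.absoluteGaloisGroup (κ.layer n),
    (κn σ).toAdd * (p : ℤ_[p]) ^ n = (κ (resGal (K := ℚ) (κ.layer n) σ)).toAdd)
  {v : HeightOneSpectrum (𝓞 ℚ)} (hpv : ((p : ℕ) : 𝓞 ℚ) ∈ v.asIdeal)
  (hΔ : ¬ (p : ℤ) ∣ minimalDiscriminantInt W)
  (wp : HeightOneSpectrum (𝓞 (κ.layer n))) [wp.asIdeal.LiesOver v.asIdeal]
  -- the factorisation data (n1011 shape)
  (ι₂ : AlgebraicClosure (v.adicCompletion ℚ) ≃+* AlgebraicClosure (wp.adicCompletion (κ.layer n)))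
  (hι₂ : ∀ x : v.adicCompletion ℚ,
    ι₂ (algebraMap (v.adicCompletion ℚ) (AlgebraicClosure (v.adicCompletion ℚ)) x) =
      algebraMap (wp.adicCompletion (κ.layer n)) (AlgebraicClosure (wp.adicCompletion (κ.layer n)))
        (adicCompletionMap (K := ℚ) (κ.layer n) v wp x))
  (ι' : AlgebraicClosure (κ.layer n) →ₐ[κ.layer n] AlgebraicClosure (wp.adicCompletion (κ.layer n)))
  (hcompat : ∀ z : AlgebraicClosure ℚ,
    ι' (closureEmb (K := ℚ) (κ.layer n) z) = ι₂ (closureEmb (K := ℚ) (v.adicCompletion ℚ) z))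
  (hfix : ∀ h : absoluteGaloisGroup (v.adicCompletion ℚ),
    resGalOfEmb (closureEmb (K := ℚ) (v.adicCompletion ℚ)) h ∈ κ.layerSubgroup n →
    ∀ y : wp.adicCompletion (κ.layer n),
      (show AlgebraicClosure (v.adicCompletion ℚ) ≃ₐ[v.adicCompletion ℚ]
          AlgebraicClosure (v.adicCompletion ℚ) from h)
        (ι₂.symm (algebraMap _ (AlgebraicClosure (wp.adicCompletion (κ.layer n))) y)) =
        ι₂.symm (algebraMap _ (AlgebraicClosure (wp.adicCompletion (κ.layer n))) y))
  (τ : Field.absoluteGaloisGroup (κ.layer n))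
  (hτ : ι' = (closureEmb (K := κ.layer n) (wp.adicCompletion (κ.layer n))).comp
    ((show AlgebraicClosure (κ.layer n) ≃ₐ[κ.layer n] AlgebraicClosure (κ.layer n) from τ) :
      AlgebraicClosure (κ.layer n) →ₐ[κ.layer n] AlgebraicClosure (κ.layer n)))

/-! ## §1. Inertia elements of `I_v ∩ Gal(ℚ̄/ℚ_∞)` come from `I_{(ℚ_n)_wp}` -/

include hι₂ in
/-- `ι₂ h ι₂⁻¹ ∈ I_{L_w}` for `h ∈ I_{ℚ_v}` (the inertia bridge of `X1/SpectralNormTransport`, restated at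
the layer WITHOUT a local `NumberField (κ.layer n)` instance: instantiating the bridge inside the main
proof below times out at `whnf`). [cite: NeukirchANT1999, Ch. II (4.8), (9.3)] -/
theorem transportAut_mem_absInertia_layer (h : absoluteGaloisGroup (v.adicCompletion ℚ))
    (hh : ∀ y : wp.adicCompletion (κ.layer n),
      (show AlgebraicClosure (v.adicCompletion ℚ) ≃ₐ[v.adicCompletion ℚ]
          AlgebraicClosure (v.adicCompletion ℚ) from h)
        (ι₂.symm (algebraMap _ (AlgebraicClosure (wp.adicCompletion (κ.layer n))) y)) =
        ι₂.symm (algebraMap _ (AlgebraicClosure (wp.adicCompletion (κ.layer n))) y))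
    (hI : h ∈ absInertia (v.adicCompletion ℚ)) :
    transportAut ι₂ h hh ∈ absInertia (wp.adicCompletion (κ.layer n)) :=
  (SpectralNormTransport.transportAut_mem_absInertia_iff (κ.layer n) v wp ι₂ hι₂ h hh).mpr hI


include hι₂ hcompat hfix in
/-- **`x ∈ I_v ∩ Gal(ℚ̄/ℚ_∞)` is `resGal(res_{ι'} g)` for some `g ∈ I_{(ℚ_n)_wp}`**: `x = res d` with
`d ∈ absInertia ℚ_v` (`inertia v` is its image), `res d ∈ ker κ ≤ Gal(ℚ̄/ℚ_n)`, and `g = ι₂ d ι₂⁻¹`.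
[cite: SerreGaloisCohomology1997, II.§1.1] [cite: NeukirchANT1999, Ch. II (9.3)] -/
theorem exists_absInertia_resGal_eq (x : inertiaIn κ.kerSubgroup v) :
    ∃ g ∈ absInertia (wp.adicCompletion (κ.layer n)),
      resGal (K := ℚ) (κ.layer n) (resGalOfEmb ι' g) =
        ((x : GreenbergSelmer.decomp (K := ℚ) v) : Field.absoluteGaloisGroup ℚ) := by
  have hx2 := (mem_inertiaIn_iff κ.kerSubgroup v (x : GreenbergSelmer.decomp v)).mp x.2
  obtain ⟨hxH, hxI⟩ := hx2
  have hxI' := Subgroup.mem_map.mp hxI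
  obtain ⟨d, hdI, hdx⟩ := hxI'
  have hdx' : resGalOfEmb (closureEmb (K := ℚ) (v.adicCompletion ℚ)) d =
      ((x : GreenbergSelmer.decomp v) : Field.absoluteGaloisGroup ℚ) := hdx
  have hmem : resGalOfEmb (closureEmb (K := ℚ) (v.adicCompletion ℚ)) d ∈ κ.layerSubgroup n :=
    κ.kerSubgroup_le_layerSubgroup n (hdx' ▸ hxH)
  refine ⟨transportAut ι₂ d (hfix d hmem),
    transportAut_mem_absInertia_layer κ n wp ι₂ hι₂ d (hfix d hmem) hdI, ?_⟩
  rw [← hdx']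
  exact resGal_resGalOfEmb_transportAut (κ.layer n) (closureEmb (K := ℚ) (v.adicCompletion ℚ))
    ι₂ ι' hcompat d (hfix d hmem)

/-! ## §2. `res_{ι'} g ∈ ker κ_n` is `kerOfKer x`, and `res g ∈ ker κ_n` -/

include hκn in
/-- **`σ ∈ Γ_{ℚ_n}` with `resGal σ = x ∈ ker κ` lies in `ker κ_n` and is `kerOfKer x`** (`ker κ_n =
resGal⁻¹(ker κ)`, `X/ZpTowerSeam`; `kerOfKer ∘ kerToKer = id`, `X/ZpTowerKernelH1`).
[cite: Washington1997, §13.1] -/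
theorem mem_kerSubgroup_and_eq_kerOfKer (σ : Field.absoluteGaloisGroup (κ.layer n))
    (x : inertiaIn κ.kerSubgroup v)
    (hσx : resGal (K := ℚ) (κ.layer n) σ =
      ((x : GreenbergSelmer.decomp (K := ℚ) v) : Field.absoluteGaloisGroup ℚ)) :
    ∃ hσ : σ ∈ κn.kerSubgroup, kerOfKer κ n κn hκn (inertiaInToH κ.kerSubgroup v x) = ⟨σ, hσ⟩ := by
  have hxH : ((x : GreenbergSelmer.decomp (K := ℚ) v) : Field.absoluteGaloisGroup ℚ) ∈ κ.kerSubgroup :=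
    ((mem_inertiaIn_iff κ.kerSubgroup v (x : GreenbergSelmer.decomp v)).mp x.2).1
  have hmemK : σ ∈ κn.kerSubgroup := by
    refine (mem_kerSubgroup_restrictTower_iff κ n κn hκn σ).mpr ?_
    -- (the two `Algebra ℚ ℚ_n` instance paths meet only beyond `instances` transparency: `exact`,
    -- not `rw`)
    have h : resGal (K := ℚ) (κ.layer n) σ ∈ κ.kerSubgroup := hσx ▸ hxH
    exact h
  refine ⟨hmemK, ?_⟩
  have hkk : kerToKer κ n κn hκn ⟨σ, hmemK⟩ = inertiaInToH κ.kerSubgroup v x :=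
    Subtype.ext ((coe_kerToKer κ n κn hκn ⟨σ, hmemK⟩).trans hσx)
  rw [← hkk, kerOfKer_kerToKer]

include hτ in
/-- **`res g ∈ ker κ_n` when `res_{ι'} g ∈ ker κ_n`**: `res_{ι'} g = τ⁻¹ (res g) τ` (`ι' = ι_{L_w} ∘ τ`,
`resGalOfEmb_comp`) and `ker κ_n` is normal (`κ_n` is a homomorphism to an abelian group).
[cite: SerreGaloisCohomology1997, II.§1.1] -/
theorem absGaloisRestrict_mem_kerSubgroup (g : absoluteGaloisGroup (wp.adicCompletion (κ.layer n)))
    (hg : resGalOfEmb ι' g ∈ κn.kerSubgroup) :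
    absGaloisRestrict (κ.layer n) (wp.adicCompletion (κ.layer n)) g ∈ κn.kerSubgroup := by
  have hres : resGalOfEmb ι' g =
      τ⁻¹ * absGaloisRestrict (κ.layer n) (wp.adicCompletion (κ.layer n)) g * τ := by
    have h1 := congrArg (fun f ↦ f g) (resGalOfEmb_comp
      (closureEmb (K := κ.layer n) (wp.adicCompletion (κ.layer n)))
      (show AlgebraicClosure (κ.layer n) ≃ₐ[κ.layer n] AlgebraicClosure (κ.layer n) from τ))
    rw [← hτ] at h1
    rw [h1, ← resGal_eq_absGaloisRestrict]
    rfl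
  have h1 : absGaloisRestrict (κ.layer n) (wp.adicCompletion (κ.layer n)) g =
      τ * resGalOfEmb ι' g * τ⁻¹ := by
    rw [hres]; group
  rw [ZpExtension.mem_kerSubgroup, h1, map_mul κn, map_mul κn, map_inv κn,
    ZpExtension.mem_kerSubgroup.mp hg, mul_one, mul_inv_cancel]

/-! ## §3. "Reduces to `Õ`" from `(ℚ_n)_wp` back to `ℚ_v` -/

omit [W.IsElliptic] in
include hpv hι₂ hcompat hτ in
/-- **Transport of the vanishing**: if `red(pointsMap(τ • Q)) = Õ` for `Q ∈ E_{ℚ_n}[p](\bar ℚ_n)`, then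
`localRed(pointsMap(β⁻¹ Q)) = Õ` over `ℚ_v` (`pointsMap(τ • Q) = (ι')_* Q` as `ι' = ι_{L_w} ∘ τ`,
and `X1/LocalPackageTransportPoints.red_pointsMapOfEmb_eq_zero_iff`).
[cite: SilvermanAEC2009, VII.§2–3] [cite: SerreGaloisCohomology1997, II.§1.1] -/
theorem localRed_eq_zero_of_red_eq_zero
    {w : Valuation (AlgebraicClosure (wp.adicCompletion (κ.layer n))) ℝ≥0}
    (hw : ∀ x, (w x : ℝ) = spectralNorm (wp.adicCompletion (κ.layer n))
      (AlgebraicClosure (wp.adicCompletion (κ.layer n))) x)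
    {M : WeierstrassCurve ↥w.valuationSubring}
    (hMK : M.baseChange (AlgebraicClosure (wp.adicCompletion (κ.layer n))) =
      (W.baseChange (κ.layer n)).baseChange (AlgebraicClosure (wp.adicCompletion (κ.layer n))))
    {red : localPoints (W.baseChange (κ.layer n)) (wp.adicCompletion (κ.layer n)) →+
      (M.map (IsLocalRing.residue ↥w.valuationSubring)).toAffine.Point}
    (hred : ∀ P, red P = M.reducePoint (Affine.Point.congrEquiv hMK.symm P)) (hΔ' : IsUnit M.Δ)
    (Q : geomTorsion (W.baseChange (κ.layer n)) (p : ℤ))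
    (hQ : red (pointsMap (W.baseChange (κ.layer n)) (wp.adicCompletion (κ.layer n))
      ((τ • Q : geomTorsion (W.baseChange (κ.layer n)) (p : ℤ)) :
        WeierstrassCurve.geomPoints (W.baseChange (κ.layer n)))) = 0) :
    localRed W p hpv hΔ (pointsMap W (v.adicCompletion ℚ)
      (((primaryBaseChangeEquiv (κ.layer n) W p).symm
        (AddSubgroup.inclusion (geomTorsion_le_geomPrimaryTorsion (W.baseChange (κ.layer n)) p) Q) :
          W.geomPrimaryTorsion p) : W.geomPoints)) = 0 := by
  have h2 := congrArg (fun f ↦ f (Q : WeierstrassCurve.geomPoints (W.baseChange (κ.layer n))))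
    (pointsMapOfEmb_comp (W.baseChange (κ.layer n))
      (closureEmb (K := κ.layer n) (wp.adicCompletion (κ.layer n)))
      (show AlgebraicClosure (κ.layer n) ≃ₐ[κ.layer n] AlgebraicClosure (κ.layer n) from τ))
  rw [← hτ] at h2
  simp only [AddMonoidHom.coe_comp, Function.comp_apply, DistribSMul.toAddMonoidHom_apply] at h2
  -- `h2 : (ι')_* Q = (ι_{L_w})_* (τ • Q)`
  rw [Literature.NumberTheory.EllipticCurves.AddSubgroup.torsionBy.coe_smul] at hQ
  change red (pointsMapOfEmb (W.baseChange (κ.layer n))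
    (closureEmb (K := κ.layer n) (wp.adicCompletion (κ.layer n)))
      (τ • (Q : WeierstrassCurve.geomPoints (W.baseChange (κ.layer n))))) = 0 at hQ
  rw [← h2] at hQ
  have h3 : (Q : WeierstrassCurve.geomPoints (W.baseChange (κ.layer n))) =
      ((primaryBaseChangeEquiv (κ.layer n) W p ((primaryBaseChangeEquiv (κ.layer n) W p).symm
        (AddSubgroup.inclusion (geomTorsion_le_geomPrimaryTorsion (W.baseChange (κ.layer n)) p) Q)) :
        (W.baseChange (κ.layer n)).geomPrimaryTorsion p) :
          WeierstrassCurve.geomPoints (W.baseChange (κ.layer n))) := by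
    rw [AddEquiv.apply_symm_apply]; rfl
  rw [h3, LocalPackageTransportPoints.red_pointsMapOfEmb_eq_zero_iff W p hpv hΔ (κ.layer n) wp hw hMK
    hred ι₂ hι₂ ι' hcompat hΔ'] at hQ
  exact hQ

/-! ## §4. The local package with the strictness clause of FILE 24b -/

set_option maxHeartbeats 400000 in -- the statement alone (FILE 24b's clause: `kerOfKer`, `β⁻¹`,
-- `inclusion`, `localRed`) plus the `ℚ`-level/`K`-general instance unifications sit at the cliff.
include hκn hpv hΔ hι₂ hcompat hfix hτ in
/-- **THE LOCAL PACKAGE (M1-local) at the prime `wp` of `ℚ_n` above `p`, for a given reduction datum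
`(w, M, red)` at `wp`.** `E/ℚ` globally minimal elliptic, `p` odd, `p ∤ Δ_E`, `p ∤ a_p`, a rational
point of order `p`, `κ` cyclotomic, Tate's local Euler–Poincaré characteristic at `(ℚ_n)_wp` (`hEP`);
factorisation data `(ι₂, ι', τ, hfix)` for `wp ∣ v ∋ p`. Then there is `𝓛 ≤ H¹((ℚ_n)_wp, E[p])` with
`𝓚_wp ≤ 𝓛`, `p² · #𝓚_wp ≤ #𝓛`, and: every cocycle `φ` over `ℚ_n` whose class localises into `𝓛` has
`localRed(pointsMap(β⁻¹ φ(kerOfKer x))) = Õ` for every `x ∈ I_v ∩ Gal(ℚ̄/ℚ_∞)` (FILE 24b's `hstrict`).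
[cite: GreenbergLNM1716, §2 Prop. 2.4, §3 Lemma 3.4 (p. 89), §5 pp. 114–118]
[cite: MilneADT2006, I Thm. 2.8] [cite: SilvermanAEC2009, VII.§2–3] -/
theorem exists_strict_addSubgroup_of_red
    {w : Valuation (AlgebraicClosure (wp.adicCompletion (κ.layer n))) ℝ≥0}
    (hw : ∀ x, (w x : ℝ) = spectralNorm (wp.adicCompletion (κ.layer n))
      (AlgebraicClosure (wp.adicCompletion (κ.layer n))) x)
    {M : WeierstrassCurve ↥w.valuationSubring}
    (hMK : M.baseChange (AlgebraicClosure (wp.adicCompletion (κ.layer n))) =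
      (W.baseChange (κ.layer n)).baseChange (AlgebraicClosure (wp.adicCompletion (κ.layer n))))
    {red : localPoints (W.baseChange (κ.layer n)) (wp.adicCompletion (κ.layer n)) →+
      (M.map (IsLocalRing.residue ↥w.valuationSubring)).toAffine.Point}
    (hred : ∀ P, red P = M.reducePoint (Affine.Point.congrEquiv hMK.symm P)) (hΔ' : IsUnit M.Δ)
    (hκ : κ.IsCyclotomic) (hodd : p ≠ 2)
    (hord : ¬ (p : ℤ) ∣ W.frobeniusTrace p) (hT : ∃ T : W.toAffine.Point, addOrderOf T = p)
    (hEP : localEulerPoincareCharacteristic (wp.adicCompletion (κ.layer n))) :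
    ∃ 𝓛 : AddSubgroup (galoisCohomology (GaloisRep.restrictField (wp.adicCompletion (κ.layer n))
        ((W.baseChange (κ.layer n)).torsionGaloisModule (p : ℤ))) 1),
      (W.baseChange (κ.layer n)).kummerLocalConditionAt (p : ℤ) (wp.adicCompletion (κ.layer n)) ≤ 𝓛 ∧
      p ^ 2 * Nat.card ((W.baseChange (κ.layer n)).kummerLocalConditionAt (p : ℤ)
        (wp.adicCompletion (κ.layer n))) ≤ Nat.card 𝓛 ∧
      ∀ φ : contOneCocycles (discreteTopRep (Field.absoluteGaloisGroup (κ.layer n))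
          (geomTorsion (W.baseChange (κ.layer n)) (p : ℤ))),
        galoisCohomology.localization ((W.baseChange (κ.layer n)).torsionGaloisModule (p : ℤ))
          (Sum.inr wp) 1 (oneCocycleClass (discreteTopRep (Field.absoluteGaloisGroup (κ.layer n))
            (geomTorsion (W.baseChange (κ.layer n)) (p : ℤ))) φ) ∈ 𝓛 →
        ∀ x : inertiaIn κ.kerSubgroup v,
          localRed W p hpv hΔ (pointsMap W (v.adicCompletion ℚ)
            (((primaryBaseChangeEquiv (κ.layer n) W p).symm
              (AddSubgroup.inclusion (geomTorsion_le_geomPrimaryTorsion (W.baseChange (κ.layer n)) p)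
                (φ.1 ((kerOfKer κ n κn hκn (inertiaInToH κ.kerSubgroup v x) : κn.kerSubgroup) :
                  Field.absoluteGaloisGroup (κ.layer n)))) : W.geomPrimaryTorsion p) :
              W.geomPoints)) = 0 := by
  have hpack := LocalPackageRat.exists_addSubgroup_redStrict W κ n κn hκn hpv hΔ wp ι₂ hι₂ ι' hcompat
    hfix τ hτ hw hMK hred hΔ' hκ hodd hord hT hEP
  obtain ⟨𝓛, h𝓛, hidx, hstr⟩ := hpack
  refine ⟨𝓛, h𝓛, hidx, fun φ hφ x ↦ ?_⟩
  -- `x = resGal(res_{ι'} g)`, `g ∈ I_{(ℚ_n)_wp}`; `σ := res_{ι'} g = kerOfKer x ∈ ker κ_n`; `res g ∈ ker κ_n`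
  have hg := exists_absInertia_resGal_eq κ n wp ι₂ hι₂ ι' hcompat hfix x
  obtain ⟨g, hgI, hgx⟩ := hg
  have hk := mem_kerSubgroup_and_eq_kerOfKer κ n κn hκn (resGalOfEmb ι' g) x hgx
  obtain ⟨hmemK, hσ⟩ := hk
  have hgH := absGaloisRestrict_mem_kerSubgroup κ n κn wp ι' τ hτ g hmemK
  -- the cocycle of the local class computed through `ι'`, evaluated at `g`
  have hψcex := LocalPackageParts.exists_cocycle_conj_eq_res (W.baseChange (κ.layer n))
    (p : ℤ) _ ι' τ hτ φ
  obtain ⟨ψc, hψc, hψcval⟩ := hψcex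
  have key := hstr _ hφ ψc hψc g hgI hgH
  rw [hψcval] at key
  rw [hσ]
  exact localRed_eq_zero_of_red_eq_zero W κ n hpv hΔ wp ι₂ hι₂ ι' hcompat τ hτ hw hMK hred hΔ' _ key

set_option maxHeartbeats 400000 in -- as `exists_strict_addSubgroup_of_red` (same statement)
include hκn hpv hΔ hι₂ hcompat hfix hτ in
/-- **THE LOCAL PACKAGE (M1-local) at the prime `wp` of `ℚ_n` above `p`.** `E/ℚ` globally minimal
elliptic, `p` odd, `p ∤ Δ_E`, `p ∤ a_p`, a rational point of order `p`, `κ` cyclotomic, and Tate's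
local Euler–Poincaré characteristic at `(ℚ_n)_wp` (`hEP`); factorisation data `(ι₂, ι', τ, hfix)`
for `wp ∣ v ∋ p`. Then there is `𝓛 ≤ H¹((ℚ_n)_wp, E[p])` with `𝓚_wp ≤ 𝓛`, `p² · #𝓚_wp ≤ #𝓛`, and:
every cocycle `φ` over `ℚ_n` whose class localises into `𝓛` has `localRed(pointsMap(β⁻¹ φ(x))) = Õ`
for every `x ∈ I_v ∩ Gal(ℚ̄/ℚ_∞)` (FILE 24b's `hstrict`, for every representative); the reduction
datum is the minimal model over the valuation ring of the spectral valuation (§1).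
[cite: GreenbergLNM1716, §2 Prop. 2.4, §3 Lemma 3.4 (p. 89), §5 pp. 114–118]
[cite: MilneADT2006, I Thm. 2.8] [cite: SilvermanAEC2009, VII.§2–3] -/
theorem exists_strict_addSubgroup (hκ : κ.IsCyclotomic) (hodd : p ≠ 2)
    (hord : ¬ (p : ℤ) ∣ W.frobeniusTrace p) (hT : ∃ T : W.toAffine.Point, addOrderOf T = p)
    (hEP : localEulerPoincareCharacteristic (wp.adicCompletion (κ.layer n))) :
    ∃ 𝓛 : AddSubgroup (galoisCohomology (GaloisRep.restrictField (wp.adicCompletion (κ.layer n))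
        ((W.baseChange (κ.layer n)).torsionGaloisModule (p : ℤ))) 1),
      (W.baseChange (κ.layer n)).kummerLocalConditionAt (p : ℤ) (wp.adicCompletion (κ.layer n)) ≤ 𝓛 ∧
      p ^ 2 * Nat.card ((W.baseChange (κ.layer n)).kummerLocalConditionAt (p : ℤ)
        (wp.adicCompletion (κ.layer n))) ≤ Nat.card 𝓛 ∧
      ∀ φ : contOneCocycles (discreteTopRep (Field.absoluteGaloisGroup (κ.layer n))
          (geomTorsion (W.baseChange (κ.layer n)) (p : ℤ))),
        galoisCohomology.localization ((W.baseChange (κ.layer n)).torsionGaloisModule (p : ℤ))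
          (Sum.inr wp) 1 (oneCocycleClass (discreteTopRep (Field.absoluteGaloisGroup (κ.layer n))
            (geomTorsion (W.baseChange (κ.layer n)) (p : ℤ))) φ) ∈ 𝓛 →
        ∀ x : inertiaIn κ.kerSubgroup v,
          localRed W p hpv hΔ (pointsMap W (v.adicCompletion ℚ)
            (((primaryBaseChangeEquiv (κ.layer n) W p).symm
              (AddSubgroup.inclusion (geomTorsion_le_geomPrimaryTorsion (W.baseChange (κ.layer n)) p)
                (φ.1 ((kerOfKer κ n κn hκn (inertiaInToH κ.kerSubgroup v x) : κn.kerSubgroup) :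
                  Field.absoluteGaloisGroup (κ.layer n)))) : W.geomPrimaryTorsion p) :
              W.geomPoints)) = 0 := by
  have hwex := wp.exists_spectralValuation
  obtain ⟨w, hw⟩ := hwex
  have hMK := LocalPackageRat.localIntModel_baseChange_layer W κ n wp w.valuationSubring
  have hΔ' := LocalPackageRat.isUnit_Δ_localIntModel_layer W κ n hpv hΔ wp hw
  have hex := @LocalReductionStrict.exists_red (κ.layer n) _ _ (W.baseChange (κ.layer n)) wp w
    ((integralModelInt W).map (algebraMap ℤ w.valuationSubring)) hMK hΔ'
  obtain ⟨red, hred⟩ := hex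
  exact exists_strict_addSubgroup_of_red W κ n κn hκn hpv hΔ wp ι₂ hι₂ ι' hcompat hfix τ hτ hw hMK
    hred hΔ' hκ hodd hord hT hEP

end Summit.BirchSwinnertonDyer.Rank1Residual.X1.LocalPackageRatStrict

end
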